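import Mathlib.NumberTheory.NumberField.InfinitePlace.Embeddings
import Literature.NumberTheory.EllipticCurves.DeligneSerreRankin
import Literature.NumberTheory.LFunctions.DirichletDensityLemmas
import HarnessLib

/-!
# Deligne–Serre 1974, Prop. 5.5 from Prop. 5.1 and Prop. 2.7

This file PROVES the named fact `Literature.NumberTheory.EllipticCurves.ModularForms.DeligneSerre1974.prop55`
(`Literature.NumberTheory.EllipticCurves.DeligneSerreRankin`; Deligne–Serre 1974, Prop. 5.5:
for a weight-one eigenform and `η > 0` there are a set of primes `X_η` with
`dens.sup X_η ≤ η` and a finite set `Y_η ⊂ ℂ` with `a_p ∈ Y_η` for `p ∉ X_η`, `p ∤ N`) from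

* `prop51` (op. cit. Prop. 5.1, Rankin's estimate `∑ |a_p|² p^{-s} ≤ log (1/(s-k)) + O(1)`);
* `prop27_eigenvalues` (op. cit. Prop. 2.7, (2.7.1)–(2.7.3): the eigenvalues `a_p`, `p ∤ N`,
  of an eigenform are algebraic integers of a number field `K`), a named fact;
* `prop27_conj` (op. cit. (2.7.4): for every embedding `τ : K → ℂ` the conjugates
  `τ(a_p)` are again the eigenvalues of a weight-`k` eigenform), a named fact;

following the printed proof (op. cit. p. 520): with `Y(c)` the finite set of integers of `K`
all of whose conjugates have `|σ(a)|² ≤ c` (Mathlib `NumberField.Embeddings.finite_of_norm_le`)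
and `X(c) = {p : a_p ∉ Y(c)}`, summing (5.1.1) over the `r = [K : ℚ]` conjugate forms gives
`c ∑_{p ∈ X(c)} p^{-s} ≤ r log (1/(s-1)) + O(1)`, whence `dens.sup X(c) ≤ r/c ≤ η` for
`c = r/η`.

## References

* P. Deligne, J.-P. Serre, *Formes modulaires de poids 1*, Ann. Sci. ÉNS (4) 7 (1974), Prop. 2.7
  (p. 512), Prop. 5.1, (5.4.1), Prop. 5.5 (pp. 518–520).
-/

noncomputable section

open scoped MatrixGroups Topology
open CongruenceSubgroup Filter

namespace Literature.NumberTheory.EllipticCurves.ModularForms.DeligneSerre1974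

/-! ### Prop. 2.7 as named facts -/

/-- **Deligne–Serre 1974, Prop. 2.7, (2.7.1)–(2.7.3).** Let `f ≠ 0` be a cusp form of type
`(k, ε)` on `Γ₀(N)` which is an eigenfunction of the `T_p`, `p ∤ N`, with eigenvalues `a_p`.
Then the `a_p` are algebraic integers lying in a finite extension `K` of `ℚ` ("(2.7.3) Les
valeurs propres des `T_p` dans `S_ℂ` sont des entiers d'une extension finie de `ℚ`"; by (2.7.1)
the `T_p` act on a lattice `L` of finite type, so the eigenvalues of one eigenform generate an
order in a number field). Here `K` is taken inside `ℂ`.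
[cite: DeligneSerreASENS1974, Prop. 2.7 (2.7.1)–(2.7.3)] -/
def prop27_eigenvalues : Prop :=
  ∀ ⦃N : ℕ⦄ [NeZero N] ⦃k : ℤ⦄ (ε : DirichletCharacter ℂ N) (f : CuspForm (Gamma1 N) k),
    f ∈ nebentypusSubspace N k ε → f ≠ 0 →
    (∀ p : ℕ, (hp : p.Prime) → ¬ p ∣ N →
      ∃ a : ℂ, (haveI : NeZero p := ⟨hp.ne_zero⟩; heckeT (Gamma1 N) k p f) = a • f) →
    ∃ K : IntermediateField ℚ ℂ, FiniteDimensional ℚ K ∧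
      ∀ p : ℕ, p.Prime → ¬ p ∣ N → heckeEigenvalue f p ∈ K ∧ IsIntegral ℤ (heckeEigenvalue f p)

/-- **Deligne–Serre 1974, Prop. 2.7, (2.7.4): conjugates of eigenforms.** "Si `f ∈ S_ℂ` est
telle que `f ∣ T_p = a_p f`, alors, pour tout automorphisme `σ` de `ℂ`, la forme `σ(f)` est
telle que `σ(f) ∣ T_p = σ(a_p) σ(f)`. Si `f` est de type `(k, ε)` sur `Γ₀(N)`, alors `σ(f)` est
de type `(k, σ(ε))`." Here for an embedding `τ : K → ℂ` of a subfield `K ⊂ ℂ` containing the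
eigenvalues `a_p` (every such `τ` extends to an automorphism of `ℂ`): there is a non-zero cusp
form `g` of the same weight and level, of some type `(k, ε')`, with `T_p g = τ(a_p) g` for all
`p ∤ N` (this is how (2.7) is used in the proof of Prop. 5.5: "les `σ(a_p)` sont également
valeurs propres des `T_p` en poids `1`"). [cite: DeligneSerreASENS1974, Prop. 2.7 (2.7.4)] -/
def prop27_conj : Prop :=
  ∀ ⦃N : ℕ⦄ [NeZero N] ⦃k : ℤ⦄ (ε : DirichletCharacter ℂ N) (f : CuspForm (Gamma1 N) k),
    f ∈ nebentypusSubspace N k ε → f ≠ 0 →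
    (∀ p : ℕ, (hp : p.Prime) → ¬ p ∣ N →
      ∃ a : ℂ, (haveI : NeZero p := ⟨hp.ne_zero⟩; heckeT (Gamma1 N) k p f) = a • f) →
    ∀ (K : IntermediateField ℚ ℂ)
      (hK : ∀ p : ℕ, p.Prime → ¬ p ∣ N → heckeEigenvalue f p ∈ K) (τ : K →+* ℂ),
      ∃ (ε' : DirichletCharacter ℂ N) (g : CuspForm (Gamma1 N) k),
        g ∈ nebentypusSubspace N k ε' ∧ g ≠ 0 ∧
        ∀ (p : ℕ) (hp : p.Prime) (hpN : ¬ p ∣ N),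
          (haveI : NeZero p := ⟨hp.ne_zero⟩; heckeT (Gamma1 N) k p g) =
            τ ⟨heckeEigenvalue f p, hK p hp hpN⟩ • g

/-! ### Auxiliary lemmas -/

/-- The Hecke eigenvalue of a non-zero eigenvector is the scalar by which `T_p` acts.
[folklore] -/
lemma heckeEigenvalue_eq_of_eq_smul {N : ℕ} [NeZero N] {k : ℤ} {g : CuspForm (Gamma1 N) k}
    (hg : g ≠ 0) {p : ℕ} [NeZero p] {a : ℂ} (h : heckeT (Gamma1 N) k p g = a • g) :
    heckeEigenvalue g p = a := by
  have h1 := heckeT_eq_heckeEigenvalue_smul g p ⟨a, h⟩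
  rw [h] at h1
  have h2 : (a - heckeEigenvalue g p) • g = 0 := by rw [sub_smul, h1, sub_self]
  rw [smul_eq_zero] at h2
  rcases h2 with h2 | h2
  · exact (sub_eq_zero.mp h2).symm
  · exact absurd h2 hg

/-! ### Prop. 5.5 -/

open Classical in
/-- **Deligne–Serre 1974, Prop. 5.5, from Prop. 5.1 and Prop. 2.7.** For a non-zero cusp form
`f` of type `(1, ε)` on `Γ₀(N)` which is an eigenfunction of the `T_p`, `p ∤ N`, and `η > 0`,
there are a set of primes `X_η` with `dens.sup X_η ≤ η` and a finite `Y_η ⊂ ℂ` with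
`a_p ∈ Y_η` for all primes `p ∉ X_η`, `p ∤ N`. With `K ∋ a_p` the number field of (2.7.3),
`r = #(K → ℂ)`, `c = r/η`, `Y(c)` the (finite) set of integers of `K` with all conjugates of
absolute value `≤ √c` and `X(c) = {p : ∃ τ, |τ(a_p)|² > c}`: summing (5.1.1) over the conjugate
eigenforms of (2.7.4) gives `c ∑_{p ∈ X(c)} p^{-s} ≤ r log (1/(s-1)) + O(1)`.
[cite: DeligneSerreASENS1974, Prop. 5.5] -/
theorem prop55_of (h51 : prop51) (h273 : prop27_eigenvalues) (h274 : prop27_conj) : prop55 := by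
  intro N _ ε f hfε hf0 heigen η hη
  -- the number field `K ∋ a_p`
  obtain ⟨K, hKfd, hK⟩ := h273 ε f hfε hf0 heigen
  haveI := hKfd
  haveI : NumberField K := NumberField.mk
  have hKmem : ∀ p : ℕ, p.Prime → ¬ p ∣ N → heckeEigenvalue f p ∈ K := fun p hp hpN ↦
    (hK p hp hpN).1
  -- conjugate eigenforms, one for each embedding `τ : K → ℂ`
  choose ε' g hgε hg0 hgT using fun τ : K →+* ℂ ↦ h274 ε f hfε hf0 heigen K hKmem τ
  have hgeig : ∀ (τ : K →+* ℂ) (p : ℕ), (hp : p.Prime) → ¬ p ∣ N →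
      ∃ a : ℂ, (haveI : NeZero p := ⟨hp.ne_zero⟩; heckeT (Gamma1 N) 1 p (g τ)) = a • g τ :=
    fun τ p hp hpN ↦ ⟨_, hgT τ p hp hpN⟩
  have hev : ∀ (τ : K →+* ℂ) (p : ℕ) (hp : p.Prime) (hpN : ¬ p ∣ N),
      heckeEigenvalue (g τ) p = τ ⟨heckeEigenvalue f p, hKmem p hp hpN⟩ := by
    intro τ p hp hpN
    haveI : NeZero p := ⟨hp.ne_zero⟩
    exact heckeEigenvalue_eq_of_eq_smul (hg0 τ) (hgT τ p hp hpN)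
  -- Rankin's bound for each conjugate form
  have h51τ : ∀ τ : K →+* ℂ, (∀ s : ℝ, 1 < s → Summable (rankinTerm (g τ) s)) ∧
      ∃ C : ℝ, ∀ᶠ s : ℝ in 𝓝[>] (1 : ℝ),
        ∑' p : ℕ, rankinTerm (g τ) s p ≤ Real.log (1 / (s - 1)) + C := by
    intro τ
    have h := h51 (ε' τ) (g τ) (hgε τ) (hg0 τ) (hgeig τ)
    simp only [Int.cast_one] at h
    exact h
  choose hsum C hC using h51τ
  -- the constants
  set r : ℕ := Fintype.card (K →+* ℂ) with hr
  have hrpos : 0 < r := Fintype.card_pos_iff.mpr ⟨(algebraMap K ℂ : K →+* ℂ)⟩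
  set c : ℝ := r / η with hc
  have hcpos : 0 < c := div_pos (Nat.cast_pos.mpr hrpos) hη
  -- the exceptional set `X(c)` and the finite set `Y(c)`
  obtain ⟨X, hXmem⟩ : ∃ X : Set ℕ, ∀ p : ℕ, p ∈ X ↔ ∃ (hp : p.Prime) (hpN : ¬ p ∣ N),
      ∃ τ : K →+* ℂ, c < ‖τ ⟨heckeEigenvalue f p, hKmem p hp hpN⟩‖ ^ 2 :=
    ⟨{p | ∃ (hp : p.Prime) (hpN : ¬ p ∣ N), ∃ τ : K →+* ℂ,
      c < ‖τ ⟨heckeEigenvalue f p, hKmem p hp hpN⟩‖ ^ 2}, fun p ↦ Iff.rfl⟩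
  have hYfin := NumberField.Embeddings.finite_of_norm_le K ℂ (Real.sqrt c)
  set Y : Finset ℂ := (hYfin.image (fun x : K ↦ (x : ℂ))).toFinset with hY
  refine ⟨X, Y, ?_, fun p hp hpN hpX ↦ ?_⟩
  swap
  · -- `a_p ∈ Y(c)` for `p ∉ X(c)`
    rw [hY, Set.Finite.mem_toFinset]
    refine ⟨⟨heckeEigenvalue f p, hKmem p hp hpN⟩, ⟨?_, fun φ ↦ ?_⟩, rfl⟩
    · exact (isIntegral_algHom_iff (algebraMap K ℂ).toIntAlgHom (algebraMap K ℂ).injective).mp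
        (hK p hp hpN).2
    · have hle : ‖φ ⟨heckeEigenvalue f p, hKmem p hp hpN⟩‖ ^ 2 ≤ c := by
        by_contra h
        exact hpX ((hXmem p).mpr ⟨hp, hpN, φ, lt_of_not_ge h⟩)
      rw [← Real.sqrt_le_sqrt_iff hcpos.le, Real.sqrt_sq (norm_nonneg _)] at hle
      exact hle
  -- the density estimate
  have hterm : ∀ (s : ℝ) (p : ℕ),
      c * (if p.Prime ∧ p ∈ X then (p : ℝ) ^ (-s) else 0) ≤
        ∑ τ : K →+* ℂ, rankinTerm (g τ) s p := by
    intro s p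
    by_cases hpp : p.Prime ∧ p ∈ X
    · rw [if_pos hpp]
      obtain ⟨hp, hpX⟩ := hpp
      obtain ⟨hp', hpN, τ, hτ⟩ := (hXmem p).mp hpX
      have h1 : c * (p : ℝ) ^ (-s) ≤ rankinTerm (g τ) s p := by
        rw [rankinTerm, if_pos ⟨hp, hpN⟩, hev τ p hp hpN]
        exact mul_le_mul_of_nonneg_right hτ.le (Real.rpow_nonneg (Nat.cast_nonneg p) _)
      exact h1.trans (Finset.single_le_sum (fun τ' _ ↦ rankinTerm_nonneg (g τ') s p)
        (Finset.mem_univ τ))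
    · rw [if_neg hpp, mul_zero]
      exact Finset.sum_nonneg fun τ _ ↦ rankinTerm_nonneg (g τ) s p
  have hbound : ∀ᶠ s : ℝ in 𝓝[>] (1 : ℝ),
      (∑' p : ℕ, (if p.Prime ∧ p ∈ X then (p : ℝ) ^ (-s) else 0)) / Real.log (1 / (s - 1)) ≤
        r / c + (∑ τ, C τ) / c / Real.log (1 / (s - 1)) := by
    have hall : ∀ᶠ s : ℝ in 𝓝[>] (1 : ℝ), ∀ τ : K →+* ℂ,
        ∑' p : ℕ, rankinTerm (g τ) s p ≤ Real.log (1 / (s - 1)) + C τ :=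
      eventually_all.mpr fun τ ↦ hC τ
    filter_upwards [hall, LFunctions.PrimeSum.eventually_log_pos, LFunctions.PrimeSum.eventually_one_lt]
      with s hs hlog hs1
    have h1 : c * ∑' p : ℕ, (if p.Prime ∧ p ∈ X then (p : ℝ) ^ (-s) else 0) ≤
        ∑ τ, ∑' p : ℕ, rankinTerm (g τ) s p := by
      rw [← tsum_mul_left, ← Summable.tsum_finsetSum (fun τ _ ↦ hsum τ s hs1)]
      exact Summable.tsum_le_tsum (hterm s) ((LFunctions.PrimeSum.summable X hs1).mul_left c)
        (summable_sum fun τ _ ↦ hsum τ s hs1)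
    have h2 : ∑ τ, ∑' p : ℕ, rankinTerm (g τ) s p ≤ r * Real.log (1 / (s - 1)) + ∑ τ, C τ := by
      calc ∑ τ, ∑' p : ℕ, rankinTerm (g τ) s p ≤ ∑ τ : K →+* ℂ, (Real.log (1 / (s - 1)) + C τ) :=
            Finset.sum_le_sum fun τ _ ↦ hs τ
        _ = r * Real.log (1 / (s - 1)) + ∑ τ, C τ := by
            rw [Finset.sum_add_distrib, Finset.sum_const, Finset.card_univ, nsmul_eq_mul, hr]
    have h3 := h1.trans h2
    have hc0 : c ≠ 0 := hcpos.ne'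
    have hL0 : Real.log (1 / (s - 1)) ≠ 0 := hlog.ne'
    have h4 : ∑' p : ℕ, (if p.Prime ∧ p ∈ X then (p : ℝ) ^ (-s) else 0) ≤
        (r * Real.log (1 / (s - 1)) + ∑ τ, C τ) / c := by
      rw [le_div_iff₀ hcpos]
      linarith [h3]
    calc (∑' p : ℕ, (if p.Prime ∧ p ∈ X then (p : ℝ) ^ (-s) else 0)) / Real.log (1 / (s - 1))
        ≤ ((r * Real.log (1 / (s - 1)) + ∑ τ, C τ) / c) / Real.log (1 / (s - 1)) :=
          div_le_div_of_nonneg_right h4 hlog.le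
      _ = r / c + (∑ τ, C τ) / c / Real.log (1 / (s - 1)) := by
          field_simp
  have hlim : Tendsto (fun s : ℝ ↦ (r : ℝ) / c + (∑ τ, C τ) / c / Real.log (1 / (s - 1)))
      (𝓝[>] (1 : ℝ)) (𝓝 ((r : ℝ) / c)) := by
    have := (tendsto_const_nhds (x := (∑ τ, C τ) / c)).div_atTop
      LFunctions.PrimeSum.tendsto_log_one_div_sub_one
    simpa using this.const_add ((r : ℝ) / c)
  have hrc : (r : ℝ) / c = η := by
    have hr0 : (r : ℝ) ≠ 0 := (Nat.cast_pos.mpr hrpos).ne'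
    rw [hc]
    field_simp
  calc upperDensity X
      ≤ limsup (fun s : ℝ ↦ (r : ℝ) / c + (∑ τ, C τ) / c / Real.log (1 / (s - 1)))
          (𝓝[>] (1 : ℝ)) := by
        unfold upperDensity
        refine limsup_le_limsup hbound ?_ hlim.isBoundedUnder_le
        exact (isBoundedUnder_of_eventually_ge (LFunctions.PrimeSum.eventually_div_log_nonneg X)).isCoboundedUnder_le
    _ = η := by rw [hlim.limsup_eq, hrc]

end Literature.NumberTheory.EllipticCurves.ModularForms.DeligneSerre1974
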